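import Literature.Probability.LatticeModels.MedialExplorationSideWinding
import Literature.Probability.LatticeModels.MedialCornerWalkRuns
import HarnessLib

/-!
# Escape along a lattice vertex path entering the start corner THROUGH the start edge

Topic `Literature/Probability/LatticeModels`; a variant of `MedialExplorationVertexEscape.lean` /
`MedialExplorationSideWinding.lean` (the winding of the medial exploration at a corner with a VERTEX
ESCAPE back to the start corner `(x₀, k₀) = startCorner hD` is `-4 - (walkTurns j ds + 1)`). There the
vertex path enters `x₀` along the direction `k₀ + 1`, through the non-inner face across the start edge
`e_a = {x₀, x₀ + u_{k₀}}`, and the escape is completed by the corner `(x₀, k₀ + 3)` of that face. When the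
outer corner `x₀ + u_{k₀+3}` of that face is an interior site this is not available; instead one lets the
vertex path arrive at the `B`-end `b₀ = x₀ + u_{k₀}` of the start edge (a site of the dual-wired arc, hence
forbidden to explorations) and traverse `e_a` itself: the last step has direction `k₀ + 2`, and the arrival
corner at `x₀` IS the start corner (the right successor of the departure corner `(b₀, k₀ + 1)`).

* `vertexEscapeB_isEscape` — the corner walk of such a path is an escape path of `(u, j)` with escape sum
  `walkTurns j ds` (no final left turn);
* `turnCount_eq_of_vertexEscapeB_side` — with an extreme corner of index `j + 3` for the side
  functional `sideVal j`, the turn count at every passage of `(u, j)` before the exit is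
  `-4 - walkTurns j ds`, for every configuration.

Everything is proved.

## References

* H. Duminil-Copin, C. Hongler, P. Nolin, Comm. Pure Appl. Math. 64 (2011), Lemma 12.
  [DuminilCopinHonglerNolin2011]
-/

namespace Literature.Probability.LatticeModels

open MedialTrail Finset DiscreteDobrushin

variable {D : DiscreteDobrushin}

section Main

variable (hD : D.IsZdAdmissible) {u : Site 2} {j : Fin 4} {ds : List (Fin 4)}

/-- **A vertex escape through the start edge is an escape path.** Hypotheses: the path leaves `u`
along its `(j+1)`-st edge, has at least two steps, ends at the start vertex `x₀` arriving along
`k₀ + 2` (i.e. from the `B`-end of the start edge), its vertices after `u` are forbidden (on `B`, or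
with no inner face around), and its non-final vertices are pairwise distinct. Conclusion: the corner
walk is an escape path of `(u, j)` with escape sum `walkTurns j ds`.
[cite: DuminilCopinHonglerNolin2011, Lemma 12] -/
theorem vertexEscapeB_isEscape (hhead : ds.head? = some (j + 1)) (hlen : 2 ≤ ds.length)
    (hend : pathEnd u ds = (startCorner hD).1) (hlast : lastDir ds = (startCorner hD).2 + 2)
    (hforb : ∀ v ∈ (pathVerts u ds).tail, (∀ i : Fin 4, ¬ D.IsInnerFace (faceAt v i)) ∨ v ∈ D.zdArcB)
    (hnodup : (pathVerts u ds).Nodup) :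
    IsEscape D hD (u, j) (fun i => (cornerWalk u j ds).getD i (startCorner hD)) ((cornerWalk u j ds).length - 2) ∧
      escapeSum (fun i => (cornerWalk u j ds).getD i (startCorner hD)) ((cornerWalk u j ds).length - 2) =
        walkTurns j ds := by
  have hds : ds ≠ [] := by rintro rfl; simp at hhead
  obtain ⟨ds', hds'⟩ : ∃ ds', ds = (j + 1) :: ds' := by
    obtain ⟨d, ds', rfl⟩ := List.exists_cons_of_ne_nil hds
    simp only [List.head?_cons, Option.some.injEq] at hhead
    exact ⟨ds', by rw [hhead]⟩
  have hW : cornerWalk u j ds = (u, j) :: cornerWalk (u + cornerUnit (j + 1)) (j + 3) ds' := by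
    rw [hds', cornerWalk_cons_succ]
  have hlen2 : (cornerWalk u j ds).length = ((cornerWalk u j ds).length - 2) + 2 := by
    have := length_le_length_cornerWalk u j ds
    omega
  -- the arrival corner at the end vertex is the start corner itself
  have harr : (pathEnd u ds, lastDir ds + 2) = startCorner hD := by
    rw [hend, hlast, fin4_add_two_add_two']
  have hEsc := IsEscape.of_list (hD := hD) (q := (u, j)) (cornerWalk u j ds) hlen2
    (by rw [head?_cornerWalk _ _ hds])
    (isChain_cornerWalk u j ds)
    (by
      rw [← harr]
      have key := isSucc_getLast_cornerWalk u j ds.dropLast (lastDir ds)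
      have heq : ds.dropLast ++ [lastDir ds] = ds := (eq_dropLast_append_lastDir hds).symm
      simp only [heq] at key
      exact key)
    (by
      intro d hd
      rw [hW, List.tail_cons] at hd
      have hv : d.1 ∈ (pathVerts u ds).tail := by
        rw [hds', pathVerts, List.tail_cons]; exact fst_mem_pathVerts hd
      rcases hforb d.1 hv with h | h
      · exact Or.inl (h d.2)
      · exact Or.inr h)
    (nodup_cornerWalk hnodup)
  refine ⟨hEsc.1, ?_⟩
  rw [hEsc.2, ← harr, walkSign_cornerWalk u j hds]

/-- Corners of the walk are values of the escape sequence at indices `≤ length - 1`. [folklore] -/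
theorem exists_index_of_mem_cornerWalk {d : Site 2 × Fin 4} (hd : d ∈ cornerWalk u j ds) :
    ∃ m ≤ (cornerWalk u j ds).length - 2 + 1, (cornerWalk u j ds).getD m (startCorner hD) = d := by
  obtain ⟨i, hi, rfl⟩ := List.mem_iff_getElem.1 hd
  exact ⟨i, by omega, List.getD_eq_getElem _ _ hi⟩

/-- Values of the escape sequence at indices `≤ length - 1` are corners of the walk (for a walk with at
least two steps). [folklore] -/
theorem getD_mem_cornerWalk (hlen : 2 ≤ ds.length) {m : ℕ} (hm : m ≤ (cornerWalk u j ds).length - 2 + 1) :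
    (cornerWalk u j ds).getD m (startCorner hD) ∈ cornerWalk u j ds := by
  have := length_le_length_cornerWalk u j ds
  rw [List.getD_eq_getElem _ _ (by omega)]
  exact List.getElem_mem _

/-- **The winding at a corner with a vertex escape through the start edge, extreme corner for the side
functional.** If a corner `d` of the walk has index `j + 3` and maximises `sideVal j ∘ cpos` over all
corners with an inner face and over the walk, then at every passage of `(u, j)` before the exit
`turnCount = -4 - walkTurns j ds`. [cite: DuminilCopinHonglerNolin2011, Lemma 12] -/
theorem turnCount_eq_of_vertexEscapeB_side (hhead : ds.head? = some (j + 1)) (hlen : 2 ≤ ds.length)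
    (hend : pathEnd u ds = (startCorner hD).1) (hlast : lastDir ds = (startCorner hD).2 + 2)
    (hforb : ∀ v ∈ (pathVerts u ds).tail, (∀ i : Fin 4, ¬ D.IsInnerFace (faceAt v i)) ∨ v ∈ D.zdArcB)
    (hnodup : (pathVerts u ds).Nodup)
    {d : Site 2 × Fin 4} (hd : d ∈ cornerWalk u j ds) (hidx : d.2 = j + 3)
    (hI : ∀ p : Site 2 × Fin 4, D.IsInnerFace (cFace p) → sideVal j (cpos p) ≤ sideVal j (cpos d))
    (hE : ∀ d' ∈ cornerWalk u j ds, sideVal j (cpos d') ≤ sideVal j (cpos d))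
    (ω : Percolation.BondConfig (Site 2)) {t : ℕ} (ht : t < exitTime hD ω)
    (horb : cornerOrbit (D.bcBondConfig ω) (startCorner hD) t = (u, j)) :
    turnCount (D.bcBondConfig ω) (startCorner hD) t = -4 - walkTurns j ds := by
  obtain ⟨hEsc, hsum⟩ := vertexEscapeB_isEscape hD hhead hlen hend hlast hforb hnodup
  obtain ⟨m₀, hm₀, hm₀d⟩ := exists_index_of_mem_cornerWalk hD hd
  rw [← hsum]
  have hEm : ∀ m ≤ (cornerWalk u j ds).length - 2 + 1,
      sideVal j (cpos ((cornerWalk u j ds).getD m (startCorner hD))) ≤ sideVal j (cpos d) :=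
    fun m hm => hE _ (getD_mem_cornerWalk hD hlen hm)
  fin_cases j
  · simp only [sideVal, Fin.zero_eta, Matrix.cons_val_zero] at hI hEm
    exact hEsc.turnCount_eq_of_top_east hm₀ (by rw [hm₀d]; exact hidx) (fun p hp => by rw [hm₀d]; exact hI p hp)
      (fun m hm => by rw [hm₀d]; exact hEm m hm) ω ht horb
  · simp only [sideVal, Fin.mk_one, Matrix.cons_val_one, Matrix.cons_val_zero, neg_le_neg_iff] at hI hEm
    exact hEsc.turnCount_eq_of_west_north hm₀ (by rw [hm₀d]; exact hidx) (fun p hp => by rw [hm₀d]; exact hI p hp)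
      (fun m hm => by rw [hm₀d]; exact hEm m hm) ω ht horb
  · simp only [sideVal, Fin.reduceFinMk, Matrix.cons_val, neg_le_neg_iff] at hI hEm
    exact hEsc.turnCount_eq_of_bot_west hm₀ (by rw [hm₀d]; exact hidx) (fun p hp => by rw [hm₀d]; exact hI p hp)
      (fun m hm => by rw [hm₀d]; exact hEm m hm) ω ht horb
  · simp only [sideVal, Fin.reduceFinMk, Matrix.cons_val] at hI hEm
    exact hEsc.turnCount_eq_of_east_south hm₀ (by rw [hm₀d]; exact hidx) (fun p hp => by rw [hm₀d]; exact hI p hp)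
      (fun m hm => by rw [hm₀d]; exact hEm m hm) ω ht horb

end Main

end Literature.Probability.LatticeModels
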